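import Summits.CriticalPhenomena.PercolationContinuityZ3.Theorems.PercNearOneGluingNoHeavyLowerTailTwoPartitionSplit
import Literature.Probability.LatticeModels.FKGEquality
import Mathlib.Combinatorics.SetFamily.HarrisKleitman
import Mathlib.Data.Fintype.Sets
import HarnessLib.Audit

/-!
# `NoHeavyLowerTail` (crux stmt-CriticalPhenomena-4575), master-family hierarchy P3 (gen 30): `ThreeSetAntipodal` for every up-set with AT MOST
# ONE COMPLEMENTARY PAIR (`#(𝒜 ∩ 𝒜ᶜˢ) ≤ 2`) — via the structure identity `N_𝒜(ℬ,𝒞) = N₂(𝒜∖𝒜ᶜˢ, ℬ∩𝒞) + #(Fℬ𝒞) − #(Fℬ𝒞ᶜˢ)` and the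
# EQUALITY CASE OF HARRIS–KLEITMAN (Chan–Pak / Ahlswede–Khachatrian, tree `Literature…FKGEquality.indep_events_iff`)

Support file (seat `prim-masterthm-p3`; `--supports stmt-CriticalPhenomena-4575`; memo
`run/shared/lean/prim/prim-masterthm/FROM-prim-masterthm-p3-g30-SPLIT-AND-PEELING.md` §3, HIERARCHY §37).  Companion of `…TwoPartitionThreeSet`
(faces: complement-free `𝒜 ∩ 𝒜ᶜˢ = ∅`, `univ`, …), `…TwoPartitionSplit/Peel/Peelable` (recursive peeling).

THE IDENTITY (`threeSetN_eq_twoPartN_add`, this work; gen 25's structure formula (0.1) in the kernel): with `U = 𝒜 ∖ 𝒜ᶜˢ` (an up-set, no complementary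
pair) and `F = 𝒜 ∩ 𝒜ᶜˢ` (the complementary pairs inside `𝒜`),
  `threeSetN 𝒜 ℬ 𝒞 = twoPartN (𝒜 ∖ 𝒜ᶜˢ) (ℬ ∩ 𝒞) + #(𝒜 ∩ 𝒜ᶜˢ ∩ ℬ ∩ 𝒞) − #(𝒜 ∩ 𝒜ᶜˢ ∩ ℬ ∩ 𝒞ᶜˢ)`
(= Kleitman sandwich of `U` against `ℬ∩𝒞` + agreeing − disagreeing `F`-pairs).

THE FACE (`threeSetN_nonneg_of_card_inter_compls_le_two`, this work, unconditional): if `#(𝒜 ∩ 𝒜ᶜˢ) ≤ 2` then `0 ≤ threeSetN 𝒜 ℬ 𝒞` for all up-sets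
`ℬ, 𝒞`.  Proof: `F = {v, vᶜ}`; unless `v ∈ ℬ ∖ 𝒞, vᶜ ∈ 𝒞 ∖ ℬ` (up to the names) the `F`-term is `≥ 0` and Kleitman finishes; in the disagreeing case
`𝒜' := 𝒜.erase v` is a complement-free up-set with `twoPartN 𝒜' (ℬ∩𝒞) = twoPartN U (ℬ∩𝒞)`, and `twoPartN 𝒜' (ℬ∩𝒞) = 0` would force equality in Harris'
inequality `2^n·#(𝒜' ∩ ℬ𝒞) = #𝒜'·#(ℬ𝒞)`, hence (EQUALITY CASE, `indep_events_iff` with the counting weight) a coordinate set `S` with `𝒜'` determined by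
`S` and `ℬ∩𝒞` by `Sᶜ`; every `j ∉ v` lies in `S` (`v ∉ 𝒜'`, `insert j v ∈ 𝒜'`), so `ℬ ∩ 𝒞 ∋ univ` is determined inside `v` and contains `v` —
contradicting `v ∉ 𝒞`.  So `twoPartN U (ℬ∩𝒞) ≥ 1` pays for the one disagreeing pair.
SCOPE: with gen 30's peeling this settles 190 of the 562 pinched up-sets of `2^[5]` (those with `|F| = 2`); `|F| ≥ 4` needs the AGREEING pairs too
(the tempting `twoPartN U (ℬ∩𝒞) ≥ #disagreeing pairs` is FALSE: `𝒜 = {#S ≥ 1}` on 3 points, `ℬ = x₃`, `𝒞 = x₂`).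
HONEST LABEL: one more face of the conjecture `ThreeSetAntipodal`; the conjecture (hence `SQKD`) stays OPEN. [this work]
-/

namespace Summit.CriticalPhenomena.PercolationContinuityZ3.Theorems.TwoPartition

open Finset
open scoped FinsetFamily

variable {α : Type*} [DecidableEq α] [Fintype α]

/-! ### The structure identity -/

/-- A function on `2^α` that is odd under complementation sums to zero. [folklore] -/
theorem sum_eq_zero_of_compl_antisymm (Q : Finset α → ℤ) (h : ∀ S, Q Sᶜ = -Q S) : ∑ S, Q S = 0 := by
  have h1 : ∑ S, Q Sᶜ = ∑ S, Q S := sum_comp_compl Q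
  have h2 : ∑ S, Q Sᶜ = -∑ S, Q S := by
    rw [← Finset.sum_neg_distrib]; exact Finset.sum_congr rfl fun S _ => h S
  linarith

/-- **Structure identity** (gen 25 (0.1), this work in the kernel):
`threeSetN 𝒜 ℬ 𝒞 = twoPartN (𝒜 ∖ 𝒜ᶜˢ) (ℬ ∩ 𝒞) + #(𝒜 ∩ 𝒜ᶜˢ ∩ ℬ ∩ 𝒞) − #(𝒜 ∩ 𝒜ᶜˢ ∩ ℬ ∩ 𝒞ᶜˢ)`. [this work] -/
theorem threeSetN_eq_twoPartN_add (𝒜 ℬ 𝒞 : Finset (Finset α)) :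
    threeSetN 𝒜 ℬ 𝒞 = twoPartN (𝒜 \ 𝒜ᶜˢ) (ℬ ∩ 𝒞) + #(𝒜 ∩ 𝒜ᶜˢ ∩ ℬ ∩ 𝒞) - #(𝒜 ∩ 𝒜ᶜˢ ∩ ℬ ∩ 𝒞ᶜˢ) := by
  rw [threeSetN_eq_sum, twoPartN_eq_sum, card_eq_sum_chi, card_eq_sum_chi, ← sub_eq_zero]
  simp only [chi_inter, chi_compls, chi_sdiff, ← Finset.sum_add_distrib, ← Finset.sum_sub_distrib]
  refine sum_eq_zero_of_compl_antisymm _ fun S => ?_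
  simp only [compl_compl]
  ring

/-! ### Up-sets with exactly one complementary pair -/

/-- If `∅ ∉ 𝒜` and `𝒜 ∩ 𝒜ᶜˢ ⊆ {v, vᶜ}` then no member of the up-set `𝒜` lies strictly below `v`. [this work] -/
theorem not_mem_of_ssubset {𝒜 : Finset (Finset α)} (h𝒜 : IsUpperSet (𝒜 : Set (Finset α))) (h0 : ∅ ∉ 𝒜) {v : Finset α}
    (hvc : vᶜ ∈ 𝒜) (hF : 𝒜 ∩ 𝒜ᶜˢ ⊆ {v, vᶜ}) {S : Finset α} (hSv : S ⊂ v) : S ∉ 𝒜 := by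
  intro hS
  have hSc : Sᶜ ∈ 𝒜 := h𝒜 (compl_subset_compl.2 hSv.subset) hvc
  have hmem : S ∈ 𝒜 ∩ 𝒜ᶜˢ := mem_inter.2 ⟨hS, mem_compls.2 hSc⟩
  have := hF hmem
  rw [mem_insert, mem_singleton] at this
  rcases this with rfl | rfl
  · exact hSv.ne rfl
  · -- `vᶜ ⊂ v` forces `vᶜ = ∅`
    have : vᶜ = ∅ := by
      rw [← subset_empty]; intro x hx
      have h1 := hSv.subset hx
      rw [mem_compl] at hx; exact absurd h1 hx
    rw [this] at hS; exact h0 hS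

/-- In that situation `𝒜.erase v` is again an up-set. [this work] -/
theorem isUpperSet_erase {𝒜 : Finset (Finset α)} (h𝒜 : IsUpperSet (𝒜 : Set (Finset α))) (h0 : ∅ ∉ 𝒜) {v : Finset α}
    (hvc : vᶜ ∈ 𝒜) (hF : 𝒜 ∩ 𝒜ᶜˢ ⊆ {v, vᶜ}) : IsUpperSet ((𝒜.erase v : Finset (Finset α)) : Set (Finset α)) := by
  intro S T hST hS
  rw [Finset.mem_coe, mem_erase] at hS ⊢
  refine ⟨?_, h𝒜 hST hS.2⟩
  rintro rfl
  exact not_mem_of_ssubset h𝒜 h0 hvc hF (lt_of_le_of_ne hST hS.1) hS.2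

/-- … and `𝒜.erase v` is complement-free when `𝒜 ∩ 𝒜ᶜˢ ⊆ {v, vᶜ}`. [this work] -/
theorem erase_inter_compls_eq_empty {𝒜 : Finset (Finset α)} {v : Finset α} (hF : 𝒜 ∩ 𝒜ᶜˢ ⊆ {v, vᶜ}) :
    𝒜.erase v ∩ (𝒜.erase v)ᶜˢ = ∅ := by
  refine eq_empty_of_forall_notMem fun S hS => ?_
  rw [mem_inter, mem_compls, mem_erase, mem_erase] at hS
  obtain ⟨⟨hSv, hS⟩, hScv, hSc⟩ := hS
  have := hF (mem_inter.2 ⟨hS, mem_compls.2 hSc⟩)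
  rw [mem_insert, mem_singleton] at this
  rcases this with rfl | rfl
  · exact hSv rfl
  · exact hScv (compl_compl v)

/-! ### The equality case of Harris–Kleitman, imported from `Literature…FKGEquality` -/

open Literature.Probability.LatticeModels.FKGEquality (IsLogSupermodular indep_events_iff)
open Literature.Probability.Percolation (DeterminedBy determinedBy_iff)
open Literature.Probability.Percolation.DecisionTree (ind)
open Literature.Combinatorics.Sahi2008 (ex ex_def)

/-- **Equality in Harris ⟹ splitting** for two up-set FAMILIES of finsets (transport of `indep_events_iff` with the counting weight): if
`2^|α|·#(𝒳 ∩ 𝒴) = #𝒳·#𝒴` then there is a coordinate set `S` such that membership in `𝒳` depends only on `· ∩ S` and membership in `𝒴` only on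
`· ∩ Sᶜ`. [cite: ChanPak2026, Thm. 9.1 (tree: `Literature…FKGEquality.indep_events_iff`)] -/
theorem exists_split_of_harris_eq {𝒳 𝒴 : Finset (Finset α)} (h𝒳 : IsUpperSet (𝒳 : Set (Finset α)))
    (h𝒴 : IsUpperSet (𝒴 : Set (Finset α))) (heq : 2 ^ Fintype.card α * #(𝒳 ∩ 𝒴) = #𝒳 * #𝒴) :
    ∃ S : Set α, (∀ T T' : Finset α, (T : Set α) ∩ S = (T' : Set α) ∩ S → (T ∈ 𝒳 ↔ T' ∈ 𝒳)) ∧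
      (∀ T T' : Finset α, (T : Set α) ∩ Sᶜ = (T' : Set α) ∩ Sᶜ → (T ∈ 𝒴 ↔ T' ∈ 𝒴)) := by
  classical
  -- the events on `Set α` read through the order isomorphism `Finset α ≃o Set α`
  let e : Set α ≃o Finset α := (Fintype.finsetOrderIsoSet (α := α)).symm
  have he : ∀ T : Finset α, e (T : Set α) = T := fun T => (Fintype.finsetOrderIsoSet (α := α)).symm_apply_apply T
  let U : Set (Set α) := {ω | e ω ∈ 𝒳}
  let V : Set (Set α) := {ω | e ω ∈ 𝒴}
  have hU : IsUpperSet U := fun ω ω' hle hω => h𝒳 (e.monotone hle) hω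
  have hV : IsUpperSet V := fun ω ω' hle hω => h𝒴 (e.monotone hle) hω
  let μ : Set α → ℝ := fun _ => 1
  have hpos : ∀ ω, 0 < μ ω := fun _ => one_pos
  have hμ : IsLogSupermodular μ := fun a b => by simp [μ]
  -- counting: `ex μ (ind E) = #` of the corresponding family
  have hex : ∀ (E : Set (Set α)) (ℰ : Finset (Finset α)), (∀ ω, ω ∈ E ↔ e ω ∈ ℰ) → ex μ (ind E) = (#ℰ : ℝ) := by
    intro E ℰ hE
    rw [ex_def]
    simp only [μ, one_mul]
    rw [Fintype.sum_equiv e.toEquiv (fun ω => ind E ω) (fun T => if T ∈ ℰ then (1 : ℝ) else 0) (fun ω => by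
      unfold ind; simp only [hE ω]; rfl)]
    rw [Finset.sum_boole, Finset.filter_mem_eq_inter, univ_inter]
  have hsum : (∑ ω : Set α, μ ω) = (2 : ℝ) ^ Fintype.card α := by
    simp only [μ, Finset.sum_const, Finset.card_univ, Fintype.card_set, nsmul_eq_mul, mul_one]
    push_cast; rfl
  have hUV : ∀ ω, ω ∈ U ∩ V ↔ e ω ∈ 𝒳 ∩ 𝒴 := fun ω => by
    simp only [Set.mem_inter_iff, mem_inter, U, V, Set.mem_setOf_eq]
  have h : (∑ ω, μ ω) * ex μ (ind (U ∩ V)) = ex μ (ind U) * ex μ (ind V) := by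
    rw [hsum, hex (U ∩ V) (𝒳 ∩ 𝒴) hUV, hex U 𝒳 (fun ω => Iff.rfl), hex V 𝒴 (fun ω => Iff.rfl)]
    exact_mod_cast heq
  obtain ⟨S, hUS, hVS, -⟩ := (indep_events_iff hpos hμ hU hV).1 h
  rw [determinedBy_iff] at hUS hVS
  refine ⟨S, fun T T' hT => ?_, fun T T' hT => ?_⟩
  · have := hUS T T' hT
    simp only [U, Set.mem_setOf_eq, he] at this
    exact this
  · have := hVS T T' hT
    simp only [V, Set.mem_setOf_eq, he] at this
    exact this

/-- **Strict Kleitman sandwich**: for up-sets `𝒳, 𝒴` with `twoPartN 𝒳 𝒴 = 0`, Harris holds with equality: `2^|α|·#(𝒳∩𝒴) = #𝒳·#𝒴`. [this work] -/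
theorem harris_eq_of_twoPartN_eq_zero {𝒳 𝒴 : Finset (Finset α)} (h𝒳 : IsUpperSet (𝒳 : Set (Finset α)))
    (h𝒴 : IsUpperSet (𝒴 : Set (Finset α))) (h0 : twoPartN 𝒳 𝒴 = 0) : 2 ^ Fintype.card α * #(𝒳 ∩ 𝒴) = #𝒳 * #𝒴 := by
  have k1 : #𝒳 * #𝒴 ≤ 2 ^ Fintype.card α * #(𝒳 ∩ 𝒴) := h𝒳.le_card_inter_finset h𝒴
  have k2 : 2 ^ Fintype.card α * #(𝒳 ∩ 𝒴ᶜˢ) ≤ #𝒳 * #𝒴ᶜˢ := h𝒳.card_inter_le_finset (isLowerSet_compls h𝒴)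
  rw [card_compls] at k2
  unfold twoPartN at h0
  have h3 : #(𝒳 ∩ 𝒴) = #(𝒳 ∩ 𝒴ᶜˢ) := by omega
  rw [← h3] at k2
  exact le_antisymm k2 k1

/-! ### The face -/

/-- **`ThreeSetAntipodal` for up-sets with at most one complementary pair** (this work, unconditional): if `#(𝒜 ∩ 𝒜ᶜˢ) ≤ 2` then
`0 ≤ threeSetN 𝒜 ℬ 𝒞` for all up-sets `ℬ, 𝒞`. [this work] -/
theorem threeSetN_nonneg_of_card_inter_compls_le_two {𝒜 ℬ 𝒞 : Finset (Finset α)} (h𝒜 : IsUpperSet (𝒜 : Set (Finset α)))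
    (hℬ : IsUpperSet (ℬ : Set (Finset α))) (h𝒞 : IsUpperSet (𝒞 : Set (Finset α))) (hF2 : #(𝒜 ∩ 𝒜ᶜˢ) ≤ 2) :
    0 ≤ threeSetN 𝒜 ℬ 𝒞 := by
  classical
  -- trivial faces: `𝒜 = univ` (⟸ `∅ ∈ 𝒜`), or `𝒜` complement-free
  by_cases h0 : ∅ ∈ 𝒜
  · have : 𝒜 = univ := eq_univ_of_forall fun S => h𝒜 (empty_subset S) h0
    rw [this]; exact threeSetN_nonneg_univ_left hℬ h𝒞
  by_cases hF0 : 𝒜 ∩ 𝒜ᶜˢ = ∅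
  · exact threeSetN_nonneg_of_inter_compls_eq_empty h𝒜 hℬ h𝒞 hF0
  -- the pair `{v, vᶜ} = 𝒜 ∩ 𝒜ᶜˢ`
  obtain ⟨v, hv⟩ := nonempty_iff_ne_empty.2 hF0
  have hvA : v ∈ 𝒜 := (mem_inter.1 hv).1
  have hvcA : vᶜ ∈ 𝒜 := mem_compls.1 (mem_inter.1 hv).2
  have hvc : vᶜ ∈ 𝒜 ∩ 𝒜ᶜˢ := mem_inter.2 ⟨hvcA, mem_compls.2 (by rw [compl_compl]; exact hvA)⟩
  have hne : v ≠ vᶜ := by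
    intro h
    have : v = ∅ := by
      rw [← subset_empty]; intro x hx
      have hx' : x ∈ vᶜ := h ▸ hx
      rw [mem_compl] at hx'; exact absurd hx hx'
    rw [this] at hvA; exact h0 hvA
  have hF : 𝒜 ∩ 𝒜ᶜˢ = {v, vᶜ} := by
    refine (eq_of_subset_of_card_le (fun S hS => ?_) ?_).symm
    · rw [mem_insert, mem_singleton] at hS; rcases hS with rfl | rfl; exacts [hv, hvc]
    · rw [card_pair hne]; exact hF2
  have hFsub : 𝒜 ∩ 𝒜ᶜˢ ⊆ {v, vᶜ} := hF.le
  -- the up-set `U = 𝒜 ∖ 𝒜ᶜˢ` and the Kleitman term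
  have hU : IsUpperSet ((𝒜 \ 𝒜ᶜˢ : Finset (Finset α)) : Set (Finset α)) := by
    intro S T hST hS
    rw [Finset.mem_coe, mem_sdiff] at hS ⊢
    exact ⟨h𝒜 hST hS.1, fun hT => hS.2 ((isLowerSet_compls h𝒜) hST hT)⟩
  have hW : IsUpperSet ((ℬ ∩ 𝒞 : Finset (Finset α)) : Set (Finset α)) := by rw [coe_inter]; exact hℬ.inter h𝒞
  have hK : 0 ≤ twoPartN (𝒜 \ 𝒜ᶜˢ) (ℬ ∩ 𝒞) := twoPartN_nonneg hU hW
  rw [threeSetN_eq_twoPartN_add, hF]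
  -- if the pair is not split oppositely, the `F`-terms are `≥ 0`… more precisely the negative term is `≤` the positive one or we are in the
  -- disagreeing configuration, which we now isolate
  by_cases hdis : ∃ w ∈ ({v, vᶜ} : Finset (Finset α)), w ∈ ℬ ∧ w ∉ 𝒞 ∧ wᶜ ∈ 𝒞 ∧ wᶜ ∉ ℬ
  swap
  · -- no disagreeing orientation: `w ↦ (w if w ∈ 𝒞 else wᶜ)` injects `{v,vᶜ} ∩ ℬ ∩ 𝒞ᶜˢ` into `{v,vᶜ} ∩ ℬ ∩ 𝒞`
    have hnd : ∀ w ∈ ({v, vᶜ} : Finset (Finset α)), w ∈ ℬ → w ∉ 𝒞 → wᶜ ∈ 𝒞 → wᶜ ∈ ℬ := by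
      intro w hwF hwB hwC hwcC
      by_contra h
      exact hdis ⟨w, hwF, hwB, hwC, hwcC, h⟩
    have hle : #({v, vᶜ} ∩ ℬ ∩ 𝒞ᶜˢ) ≤ #({v, vᶜ} ∩ ℬ ∩ 𝒞) := by
      refine card_le_card_of_injOn (fun w => if w ∈ 𝒞 then w else wᶜ) (fun w hw => ?_) ?_
      · rw [mem_coe, mem_inter, mem_inter, mem_compls] at hw
        obtain ⟨⟨hwF, hwB⟩, hwcC⟩ := hw
        dsimp only
        by_cases hwC : w ∈ 𝒞
        · rw [if_pos hwC, mem_coe, mem_inter, mem_inter]; exact ⟨⟨hwF, hwB⟩, hwC⟩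
        · have hwcB : wᶜ ∈ ℬ := hnd w hwF hwB hwC hwcC
          rw [if_neg hwC, mem_coe, mem_inter, mem_inter]
          refine ⟨⟨?_, hwcB⟩, hwcC⟩
          rw [mem_insert, mem_singleton] at hwF ⊢
          rcases hwF with rfl | rfl
          · exact Or.inr rfl
          · exact Or.inl (compl_compl v)
      · intro w hw w' hw' hww'
        rw [mem_coe, mem_inter, mem_inter, mem_compls] at hw hw'
        dsimp only at hww'
        by_cases hwC : w ∈ 𝒞 <;> by_cases hw'C : w' ∈ 𝒞
        · rwa [if_pos hwC, if_pos hw'C] at hww'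
        · rw [if_pos hwC, if_neg hw'C] at hww'
          -- `w = w'ᶜ`, so `w'ᶜ ∈ 𝒞` gives `w ∈ 𝒞`… and `wᶜ = w'`; `hw.2 : wᶜ ∈ 𝒞` contradicts `hw'C`
          exfalso; apply hw'C; rw [← compl_compl w', ← hww']; exact hw.2
        · rw [if_neg hwC, if_pos hw'C] at hww'
          exfalso; apply hwC; rw [← compl_compl w, hww']; exact hw'.2
        · rw [if_neg hwC, if_neg hw'C] at hww'
          exact compl_injective hww'
    have : (#({v, vᶜ} ∩ ℬ ∩ 𝒞ᶜˢ) : ℤ) ≤ #({v, vᶜ} ∩ ℬ ∩ 𝒞) := by exact_mod_cast hle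
    linarith
  -- the disagreeing configuration: rename so that `w ∈ ℬ ∖ 𝒞`, `wᶜ ∈ 𝒞 ∖ ℬ`
  obtain ⟨w, hwF, hwB, hwC, hwcC, hwcB⟩ := hdis
  have hwA : w ∈ 𝒜 := by
    rw [mem_insert, mem_singleton] at hwF; rcases hwF with rfl | rfl; exacts [hvA, hvcA]
  have hwcA : wᶜ ∈ 𝒜 := by
    rw [mem_insert, mem_singleton] at hwF; rcases hwF with rfl | rfl
    · exact hvcA
    · rw [compl_compl]; exact hvA
  have hpair : ({v, vᶜ} : Finset (Finset α)) = {w, wᶜ} := by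
    rw [mem_insert, mem_singleton] at hwF; rcases hwF with rfl | rfl
    · rfl
    · rw [compl_compl, pair_comm]
  have hFw : 𝒜 ∩ 𝒜ᶜˢ ⊆ {w, wᶜ} := hpair ▸ hFsub
  -- the two `F`-cardinalities are `0` and `1`
  have hpos' : #({v, vᶜ} ∩ ℬ ∩ 𝒞) = 0 := by
    rw [hpair, card_eq_zero]
    refine eq_empty_of_forall_notMem fun S hS => ?_
    rw [mem_inter, mem_inter, mem_insert, mem_singleton] at hS
    rcases hS with ⟨⟨rfl | rfl, hB⟩, hC⟩
    · exact hwC hC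
    · exact hwcB hB
  have hneg' : #({v, vᶜ} ∩ ℬ ∩ 𝒞ᶜˢ) ≤ 1 := by
    rw [hpair]
    calc #({w, wᶜ} ∩ ℬ ∩ 𝒞ᶜˢ) ≤ #({w, wᶜ} ∩ ℬ) := card_le_card inter_subset_left
      _ ≤ #{w} := card_le_card (fun S hS => by
          rw [mem_inter, mem_insert, mem_singleton] at hS
          rcases hS with ⟨rfl | rfl, hB⟩
          · exact mem_singleton_self _
          · exact absurd hB hwcB)
      _ = 1 := card_singleton w
  -- so it suffices that the Kleitman term is `≥ 1`; compare it with the complement-free up-set `𝒜.erase w`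
  have hA'up : IsUpperSet ((𝒜.erase w : Finset (Finset α)) : Set (Finset α)) := isUpperSet_erase h𝒜 h0 hwcA hFw
  have hA'cf : 𝒜.erase w ∩ (𝒜.erase w)ᶜˢ = ∅ := erase_inter_compls_eq_empty hFw
  have hUeq : 𝒜 \ 𝒜ᶜˢ = (𝒜.erase w).erase wᶜ := by
    ext S
    rw [mem_sdiff, mem_erase, mem_erase, mem_compls]
    constructor
    · rintro ⟨hS, hSc⟩
      refine ⟨?_, ?_, hS⟩
      · rintro rfl; exact hSc (by rw [compl_compl]; exact hwA)
      · rintro rfl; exact hSc hwcA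
    · rintro ⟨hS1, hS2, hS⟩
      refine ⟨hS, fun hSc => ?_⟩
      have := hFw (mem_inter.2 ⟨hS, mem_compls.2 hSc⟩)
      rw [mem_insert, mem_singleton] at this
      rcases this with rfl | rfl
      · exact hS2 rfl
      · exact hS1 rfl
  have hT : twoPartN (𝒜 \ 𝒜ᶜˢ) (ℬ ∩ 𝒞) = twoPartN (𝒜.erase w) (ℬ ∩ 𝒞) := by
    -- `wᶜ ∉ ℬ ∩ 𝒞` and `(wᶜ)ᶜ = w ∉ ℬ ∩ 𝒞`, so erasing `wᶜ` changes neither count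
    unfold twoPartN
    rw [hUeq]
    have e1 : (𝒜.erase w).erase wᶜ ∩ (ℬ ∩ 𝒞) = 𝒜.erase w ∩ (ℬ ∩ 𝒞) := by
      rw [erase_inter, erase_eq_of_notMem]
      rw [mem_inter, mem_inter]; exact fun h => hwcB h.2.1
    have e2 : (𝒜.erase w).erase wᶜ ∩ (ℬ ∩ 𝒞)ᶜˢ = 𝒜.erase w ∩ (ℬ ∩ 𝒞)ᶜˢ := by
      rw [erase_inter, erase_eq_of_notMem]
      rw [mem_inter, mem_compls, compl_compl, mem_inter]; exact fun h => hwC h.2.2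
    rw [e1, e2]
  -- Kleitman for `𝒜.erase w` is `≥ 0`; if it were `= 0`, Harris' equality would split the cube
  have hK' : 0 ≤ twoPartN (𝒜.erase w) (ℬ ∩ 𝒞) := twoPartN_nonneg hA'up hW
  suffices hne0 : twoPartN (𝒜.erase w) (ℬ ∩ 𝒞) ≠ 0 by
    have h1 : 1 ≤ twoPartN (𝒜 \ 𝒜ᶜˢ) (ℬ ∩ 𝒞) := by rw [hT]; omega
    have h2 : (#({v, vᶜ} ∩ ℬ ∩ 𝒞ᶜˢ) : ℤ) ≤ 1 := by exact_mod_cast hneg'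
    rw [hpos']; push_cast; linarith
  intro hz
  obtain ⟨S, hAS, hWS⟩ := exists_split_of_harris_eq hA'up hW (harris_eq_of_twoPartN_eq_zero hA'up hW hz)
  -- every coordinate outside `w` is in `S`: `w ∉ 𝒜.erase w` but `insert j w ∈ 𝒜.erase w`
  have hSc : Sᶜ ⊆ (w : Set α) := by
    intro j hj
    by_contra hjw
    have hjw' : j ∉ w := hjw
    have hins : insert j w ∈ 𝒜.erase w :=
      mem_erase.2 ⟨fun h => hjw' (h ▸ mem_insert_self j w), h𝒜 (subset_insert j w) hwA⟩
    have hnot : w ∉ 𝒜.erase w := fun h => (mem_erase.1 h).1 rfl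
    have hagree : ((insert j w : Finset α) : Set α) ∩ S = (w : Set α) ∩ S := by
      ext x
      simp only [Set.mem_inter_iff, mem_coe, mem_insert]
      constructor
      · rintro ⟨hx | hx, hxS⟩
        · subst hx; exact absurd hxS hj
        · exact ⟨hx, hxS⟩
      · rintro ⟨hx, hxS⟩; exact ⟨Or.inr hx, hxS⟩
    exact hnot ((hAS _ _ hagree).1 hins)
  -- `univ ∈ ℬ ∩ 𝒞` agrees with `w` on `Sᶜ`, hence `w ∈ ℬ ∩ 𝒞` — contradicting `w ∉ 𝒞`
  have huniv : (univ : Finset α) ∈ ℬ ∩ 𝒞 := mem_inter.2 ⟨hℬ (subset_univ w) hwB, h𝒞 (subset_univ wᶜ) hwcC⟩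
  have hagree : ((univ : Finset α) : Set α) ∩ Sᶜ = (w : Set α) ∩ Sᶜ := by
    ext x
    simp only [Set.mem_inter_iff, coe_univ, Set.mem_univ, true_and, mem_coe]
    exact ⟨fun hx => ⟨hSc hx, hx⟩, fun h => h.2⟩
  have hwW : w ∈ ℬ ∩ 𝒞 := (hWS _ _ hagree).1 huniv
  exact hwC (mem_inter.1 hwW).2

end Summit.CriticalPhenomena.PercolationContinuityZ3.Theorems.TwoPartition
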